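import Summits.QuantumFields.YangMills.Theorems.ColdStartUniversalityShenZhuZhuW2DiracContractionSU2
import Summits.QuantumFields.YangMills.Theorems.ColdStartUniversalityShenZhuZhuW1GeometricErgodicitySU2
import HarnessLib

/-!
# `W₂` GEOMETRIC ERGODICITY of the `SU(2)` lattice Langevin dynamics on `(ℤ/L)³`, `|β'| < 1/12`, VOLUME-UNIFORM RATE:
# `W₂^{ρ_L}(νP_t, ν'P_t) ≤ e^(−(1−12|β'|)t)·W₂^{ρ_L}(ν, ν')` for ALL initial laws (Bakry–Gentil–Ledoux Thm 9.7.2 (ii) / Remark 9.7.3), and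
# `W₂^{ρ_L}(νP_t, μ_(β')) ≤ e^(−(1−12|β'|)t)·W₂^{ρ_L}(ν, μ_(β'))`, `W₂^{ρ_L}(δ_Q P_t, μ_(β'))² ≤ e^(−2(1−12|β'|)t)·2π²·#E`

Seat `ym-line-csu-p1` (g42), route `ColdStartUniversality` of `Summits/QuantumFields/YangMills`, helper file G66 (`--supports stmt-QuantumFields-24809`).
G65 proved Shen–Zhu–Zhu's (4.5) in `W₂` from Dirac initial data.  This file passes to arbitrary initial laws, coupling by coupling: by Feller continuity
(`continuous_integral_transitionKernel`) the pair `(κ_tφ, κ_tψ)` is a continuous Kantorovich pair for the cost `e^(−2ct)ρ_L²` whenever `φ ⊕ ψ ≤ ρ_L²`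
(G65 `wilson_kuwada_pairs`), so every dual value of `(νP_t, ν'P_t)` is bounded by `e^(−2ct)∫ρ_L² dq` for every coupling `q` of `ν, ν'`; Kantorovich
duality (tree) turns this into the coupling statement.  With the invariance of the Wilson–Gibbs law (`wilson_invariant_of_fact` +
`wilsonMeasureLangevinInvariant_su2`): `W₂` convergence to equilibrium from every initial law, in particular from every cold start.

* ★★ `wilson_W2_pairs_of_coupling` — `∫φ d(κ_t∘ν) + ∫ψ d(κ_t∘ν') ≤ e^(−2(1−12|β'|)t)·∫ρ_L² dq` for continuous `φ ⊕ ψ ≤ ρ_L²`, every coupling `q`;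
* ★★★ `wilson_szzWasserstein_W2_contraction_of_initialLaws` — `W₂²(νP_t, ν'P_t) ≤ e^(−2(1−12|β'|)t)·W₂²(ν,ν')` (both sides `szzWassersteinSq ρ_L²`);
* ★★★ `wilson_szzWasserstein_W2_convergence_of_initialLaw` — `W₂²(νP_t, μ_(β')) ≤ e^(−2(1−12|β'|)t)·W₂²(ν, μ_(β'))`;
* ★★ `szzWasserstein_W2_dirac_le` — `W₂²(δ_Q, μ) ≤ ∫ρ_L(Q,·)² dμ`;  ★★★ `wilson_szzWasserstein_W2_convergence_dirac(_diam)` — from a cold start,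
  `W₂²(κ_t(Q,·), μ_(β')) ≤ e^(−2(1−12|β'|)t)·∫ρ_L(Q,·)²dμ_(β') ≤ e^(−2(1−12|β'|)t)·2π²·#E`.

THEOREMS ONLY, no definition, no sorry.  HONEST FRAMING: fixed cut-off, finite volume, `|β'| < 1/12`, `t > 0`; nothing `K`-uniform along the route's
scaling; `UniformColdStartMixing` (24809, ASIDE) is not restated; no crux, rung or summit statement is proved; the Yang–Mills mass gap is NOT proved.
-/

set_option autoImplicit false

noncomputable section

namespace Summit.QuantumFields.YangMills.Theorems.ColdStartUniversality

open MeasureTheory ProbabilityTheory Matrix Complex Finset Filter Topology Set Metric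
open scoped BigOperators NNReal ENNReal
open Literature.MathematicalPhysics.QuantumFieldTheory
open Literature.MathematicalPhysics.QuantumLattice (fundamentalRep fundamentalLatticeRep continuous_fundamentalRep fundamentalRep_apply fundamentalLatticeRep_N)

variable {L : ℕ} [NeZero L]

/-! ## §1. Kantorovich pairs transported by a coupling of the initial laws -/

/-- ★★ **Dual pairs under a coupling of the initial laws.**  For `|β'| < 1/12`, `t > 0`, continuous `φ, ψ` with `φ(u) + ψ(v) ≤ ρ_L(u,v)²` and every coupling
`q` of the initial laws `ν, ν'`:  `∫φ d(κ_t∘ν) + ∫ψ d(κ_t∘ν') ≤ e^(−2(1−12|β'|)t)·∫ρ_L(z₁,z₂)² dq(z)` (G65 pointwise in `(z₁,z₂)`, Feller continuity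
of `κ_tφ`, `κ_tψ`). [cite: BakryGentilLedoux2014, Thm 9.7.2] -/
theorem wilson_W2_pairs_of_coupling (L : ℕ) [NeZero L] (β' : ℝ) (hβ : |β'| < 1 / 12)
    (κ : ℝ≥0 → Kernel (GaugeConfig 3 L (Matrix.specialUnitaryGroup (Fin 2) ℂ))
      (GaugeConfig 3 L (Matrix.specialUnitaryGroup (Fin 2) ℂ))) [∀ t, IsMarkovKernel (κ t)]
    (hreal : ∀ (t : ℝ≥0) (x : GaugeConfig 3 L (Matrix.specialUnitaryGroup (Fin 2) ℂ))
        (Ω : Type) [MeasurableSpace Ω] (P : Measure Ω) [IsProbabilityMeasure P]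
        (W : ℝ≥0 → Ω → (Edge 3 L × NoiseIdx 2 → ℝ)) (hW : IsFlatBrownian W P)
        (U : ℝ≥0 → Ω → GaugeConfig 3 L (Matrix.specialUnitaryGroup (Fin 2) ℂ)),
        (∀ ω, U 0 ω = x) →
        (latticeLangevinDynamics (fundamentalLatticeRep 2) β').IsSolution (fundamentalRep (Fin 2))
          hW.natFiltration P W U →
        κ t x = P.map (U t))
    {t : ℝ≥0} (ht : 0 < (t : ℝ)) {φ ψ : GaugeConfig 3 L (Matrix.specialUnitaryGroup (Fin 2) ℂ) → ℝ} (hφ : Continuous φ) (hψ : Continuous ψ)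
    (h : ∀ u v, φ u + ψ v ≤ torusRiemannDistSq (fundamentalLatticeRep 2) u v)
    (ν ν' : Measure (GaugeConfig 3 L (Matrix.specialUnitaryGroup (Fin 2) ℂ))) [IsProbabilityMeasure ν] [IsProbabilityMeasure ν']
    {cpl : Measure (GaugeConfig 3 L (Matrix.specialUnitaryGroup (Fin 2) ℂ) × GaugeConfig 3 L (Matrix.specialUnitaryGroup (Fin 2) ℂ))}
    (hπ : Literature.Geometry.Riemannian.IsCoupling ν ν' cpl) :
    ∫ y, φ y ∂(κ t ∘ₘ ν) + ∫ y, ψ y ∂(κ t ∘ₘ ν') ≤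
      Real.exp (-(2 * (1 - 12 * |β'|) * (t : ℝ))) * ∫ z, torusRiemannDistSq (fundamentalLatticeRep 2) z.1 z.2 ∂cpl := by
  haveI := borelSpace_config L
  haveI : IsProbabilityMeasure cpl := hπ.1
  haveI : IsProbabilityMeasure (κ t ∘ₘ ν) := by
    constructor; rw [Measure.bind_apply MeasurableSet.univ (κ t).measurable.aemeasurable]; simp
  haveI : IsProbabilityMeasure (κ t ∘ₘ ν') := by
    constructor; rw [Measure.bind_apply MeasurableSet.univ (κ t).measurable.aemeasurable]; simp
  have hκφ : Continuous fun x => ∫ y, φ y ∂(κ t x) := continuous_integral_transitionKernel L β' κ hreal t hφ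
  have hκψ : Continuous fun x => ∫ y, ψ y ∂(κ t x) := continuous_integral_transitionKernel L β' κ hreal t hψ
  have h1 : ∫ y, φ y ∂(κ t ∘ₘ ν) = ∫ z, (∫ y, φ y ∂(κ t z.1)) ∂cpl := by
    rw [Literature.Probability.Process.Harris.integral_comp_measure (κ t) ν
      (hφ.integrable_of_hasCompactSupport (HasCompactSupport.of_compactSpace φ)), ← hπ.2.1, Measure.fst,
      integral_map measurable_fst.aemeasurable (hκφ.aestronglyMeasurable)]
  have h2 : ∫ y, ψ y ∂(κ t ∘ₘ ν') = ∫ z, (∫ y, ψ y ∂(κ t z.2)) ∂cpl := by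
    rw [Literature.Probability.Process.Harris.integral_comp_measure (κ t) ν'
      (hψ.integrable_of_hasCompactSupport (HasCompactSupport.of_compactSpace ψ)), ← hπ.2.2, Measure.snd,
      integral_map measurable_snd.aemeasurable (hκψ.aestronglyMeasurable)]
  have hi1 : Integrable (fun z : GaugeConfig 3 L (Matrix.specialUnitaryGroup (Fin 2) ℂ) × GaugeConfig 3 L (Matrix.specialUnitaryGroup (Fin 2) ℂ) =>
      ∫ y, φ y ∂(κ t z.1)) cpl := (hκφ.comp continuous_fst).integrable_of_hasCompactSupport (HasCompactSupport.of_compactSpace _)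
  have hi2 : Integrable (fun z : GaugeConfig 3 L (Matrix.specialUnitaryGroup (Fin 2) ℂ) × GaugeConfig 3 L (Matrix.specialUnitaryGroup (Fin 2) ℂ) =>
      ∫ y, ψ y ∂(κ t z.2)) cpl := (hκψ.comp continuous_snd).integrable_of_hasCompactSupport (HasCompactSupport.of_compactSpace _)
  have hρi : Integrable (fun z : GaugeConfig 3 L (Matrix.specialUnitaryGroup (Fin 2) ℂ) × GaugeConfig 3 L (Matrix.specialUnitaryGroup (Fin 2) ℂ) =>
      torusRiemannDistSq (fundamentalLatticeRep 2) z.1 z.2) cpl := continuous_torusRiemannDistSq_two.integrable_of_hasCompactSupport (HasCompactSupport.of_compactSpace _)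
  rw [h1, h2, ← integral_add hi1 hi2, ← integral_const_mul]
  refine integral_mono (hi1.add hi2) (hρi.const_mul _) fun z => ?_
  exact wilson_kuwada_pairs L β' hβ κ hreal ht hφ hψ h z.1 z.2

/-! ## §2. `W₂(νP_t, ν'P_t) ≤ e^(−(1−12|β'|)t)·W₂(ν, ν')` -/

/-- ★★★ **`W₂` contraction for arbitrary initial laws** (both sides as the coupling infimum `szzWassersteinSq ρ_L²`): for `|β'| < 1/12`, `t > 0`, every
realising kernel family and all probability laws `ν, ν'`:  `szzWassersteinSq ρ_L² (κ_t∘ν) (κ_t∘ν') ≤ ofReal(e^(−2(1−12|β'|)t))·szzWassersteinSq ρ_L² ν ν'`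
— Bakry–Gentil–Ledoux Thm 9.7.2 (ii) / Remark 9.7.3 for the `SU(2)` SZZ dynamics, uniformly in the volume. [cite: BakryGentilLedoux2014, Thm 9.7.2] [cite: Villani2003, Thm. 1.3] -/
theorem wilson_szzWasserstein_W2_contraction_of_initialLaws (L : ℕ) [NeZero L]
    (ν ν' : Measure (GaugeConfig 3 L (Matrix.specialUnitaryGroup (Fin 2) ℂ))) [IsProbabilityMeasure ν] [IsProbabilityMeasure ν'] (β' : ℝ) (hβ : |β'| < 1 / 12)
    (κ : ℝ≥0 → Kernel (GaugeConfig 3 L (Matrix.specialUnitaryGroup (Fin 2) ℂ))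
      (GaugeConfig 3 L (Matrix.specialUnitaryGroup (Fin 2) ℂ))) [∀ t, IsMarkovKernel (κ t)]
    (hreal : ∀ (t : ℝ≥0) (x : GaugeConfig 3 L (Matrix.specialUnitaryGroup (Fin 2) ℂ))
        (Ω : Type) [MeasurableSpace Ω] (P : Measure Ω) [IsProbabilityMeasure P]
        (W : ℝ≥0 → Ω → (Edge 3 L × NoiseIdx 2 → ℝ)) (hW : IsFlatBrownian W P)
        (U : ℝ≥0 → Ω → GaugeConfig 3 L (Matrix.specialUnitaryGroup (Fin 2) ℂ)),
        (∀ ω, U 0 ω = x) →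
        (latticeLangevinDynamics (fundamentalLatticeRep 2) β').IsSolution (fundamentalRep (Fin 2))
          hW.natFiltration P W U →
        κ t x = P.map (U t))
    {t : ℝ≥0} (ht : 0 < (t : ℝ)) :
    szzWassersteinSq (torusRiemannDistSq (fundamentalLatticeRep 2)) (κ t ∘ₘ ν) (κ t ∘ₘ ν') ≤
      ENNReal.ofReal (Real.exp (-(2 * (1 - 12 * |β'|) * (t : ℝ)))) * szzWassersteinSq (torusRiemannDistSq (fundamentalLatticeRep 2)) ν ν' := by
  classical
  haveI := secondCountableTopology_su2
  haveI := borelSpace_config L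
  haveI : IsProbabilityMeasure (κ t ∘ₘ ν) := by
    constructor; rw [Measure.bind_apply MeasurableSet.univ (κ t).measurable.aemeasurable]; simp
  haveI : IsProbabilityMeasure (κ t ∘ₘ ν') := by
    constructor; rw [Measure.bind_apply MeasurableSet.univ (κ t).measurable.aemeasurable]; simp
  have hnn : ∀ u v : GaugeConfig 3 L (Matrix.specialUnitaryGroup (Fin 2) ℂ), 0 ≤ torusRiemannDistSq (fundamentalLatticeRep 2) u v := fun u v => by
    unfold torusRiemannDistSq; exact Finset.sum_nonneg fun _ _ => sq_nonneg _
  have hzero : ∀ u v : GaugeConfig 3 L (Matrix.specialUnitaryGroup (Fin 2) ℂ), Real.sqrt (torusRiemannDistSq (fundamentalLatticeRep 2) u v) = 0 ↔ u = v := fun u v => by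
    rw [Real.sqrt_eq_zero (hnn u v), torusRiemannDistSq_two_eq_zero_iff]
  have hself : ∀ u : GaugeConfig 3 L (Matrix.specialUnitaryGroup (Fin 2) ℂ), Real.sqrt (torusRiemannDistSq (fundamentalLatticeRep 2) u u) = 0 := fun u => (hzero u u).2 rfl
  have hcomm : ∀ u v : GaugeConfig 3 L (Matrix.specialUnitaryGroup (Fin 2) ℂ), Real.sqrt (torusRiemannDistSq (fundamentalLatticeRep 2) u v) = Real.sqrt (torusRiemannDistSq (fundamentalLatticeRep 2) v u) :=
    fun u v => by rw [torusRiemannDistSq_two_comm]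
  have htri : ∀ u v w : GaugeConfig 3 L (Matrix.specialUnitaryGroup (Fin 2) ℂ), Real.sqrt (torusRiemannDistSq (fundamentalLatticeRep 2) u w) ≤
      Real.sqrt (torusRiemannDistSq (fundamentalLatticeRep 2) u v) + Real.sqrt (torusRiemannDistSq (fundamentalLatticeRep 2) v w) :=
    fun u v w => sqrt_torusRiemannDistSq_two_triangle u v w
  have hcont2 : Continuous fun p : (GaugeConfig 3 L (Matrix.specialUnitaryGroup (Fin 2) ℂ)) × (GaugeConfig 3 L (Matrix.specialUnitaryGroup (Fin 2) ℂ)) =>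
      torusRiemannDistSq (fundamentalLatticeRep 2) p.1 p.2 := continuous_torusRiemannDistSq_two
  letI : MetricSpace (GaugeConfig 3 L (Matrix.specialUnitaryGroup (Fin 2) ℂ)) :=
    { __ := PseudoMetricSpace.ofDistTopology (fun u v : GaugeConfig 3 L (Matrix.specialUnitaryGroup (Fin 2) ℂ) => Real.sqrt (torusRiemannDistSq (fundamentalLatticeRep 2) u v))
        hself hcomm htri isOpen_iff_riemannDist_ball,
      eq_of_dist_eq_zero := fun {u v} huv => (hzero u v).1 huv }
  let c : C((GaugeConfig 3 L (Matrix.specialUnitaryGroup (Fin 2) ℂ)) × (GaugeConfig 3 L (Matrix.specialUnitaryGroup (Fin 2) ℂ)), ℝ) :=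
    ⟨fun p => torusRiemannDistSq (fundamentalLatticeRep 2) p.1 p.2, hcont2⟩
  obtain ⟨π, hπ, hlub⟩ := Literature.MeasureTheory.OptimalTransport.exists_isCoupling_isLUB_integral (μ := κ t ∘ₘ ν) (ν := κ t ∘ₘ ν')
    (by rw [measure_univ, measure_univ]) c
  have hprob : IsProbabilityMeasure π := by
    constructor
    have h1 : π.map Prod.fst Set.univ = 1 := by rw [hπ.map_fst]; exact measure_univ
    rwa [Measure.map_apply measurable_fst MeasurableSet.univ, Set.preimage_univ] at h1
  haveI := hprob
  have hπ' : Literature.Geometry.Riemannian.IsCoupling (κ t ∘ₘ ν) (κ t ∘ₘ ν') π := ⟨hprob, hπ.map_fst, hπ.map_snd⟩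
  have hρi : Integrable (fun z : (GaugeConfig 3 L (Matrix.specialUnitaryGroup (Fin 2) ℂ)) × (GaugeConfig 3 L (Matrix.specialUnitaryGroup (Fin 2) ℂ)) =>
      torusRiemannDistSq (fundamentalLatticeRep 2) z.1 z.2) π := hcont2.integrable_of_hasCompactSupport (HasCompactSupport.of_compactSpace _)
  -- the left-hand side is at most `∫ c dπ`
  have hlhs : szzWassersteinSq (torusRiemannDistSq (fundamentalLatticeRep 2)) (κ t ∘ₘ ν) (κ t ∘ₘ ν') ≤ ENNReal.ofReal (∫ z, c z ∂π) := by
    calc szzWassersteinSq (torusRiemannDistSq (fundamentalLatticeRep 2)) (κ t ∘ₘ ν) (κ t ∘ₘ ν')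
        ≤ ∫⁻ z, ENNReal.ofReal (torusRiemannDistSq (fundamentalLatticeRep 2) z.1 z.2) ∂π := szzWassersteinSq_le _ hπ'
      _ = ENNReal.ofReal (∫ z, torusRiemannDistSq (fundamentalLatticeRep 2) z.1 z.2 ∂π) :=
          (ofReal_integral_eq_lintegral_ofReal hρi (ae_of_all _ fun z => hnn z.1 z.2)).symm
      _ = ENNReal.ofReal (∫ z, c z ∂π) := rfl
  -- `∫ c dπ` is the least upper bound of the dual values, each bounded coupling by coupling (§1)
  set a : ℝ := Real.exp (-(2 * (1 - 12 * |β'|) * (t : ℝ))) with ha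
  have ha0 : 0 < a := Real.exp_pos _
  refine hlhs.trans ?_
  unfold szzWassersteinSq
  rw [ENNReal.mul_iInf_of_ne (ENNReal.ofReal_pos.2 ha0).ne' ENNReal.ofReal_ne_top]
  refine le_iInf fun q => ?_
  haveI := q.2.1
  have hρq : Integrable (fun z : (GaugeConfig 3 L (Matrix.specialUnitaryGroup (Fin 2) ℂ)) × (GaugeConfig 3 L (Matrix.specialUnitaryGroup (Fin 2) ℂ)) =>
      torusRiemannDistSq (fundamentalLatticeRep 2) z.1 z.2) (q : Measure _) := hcont2.integrable_of_hasCompactSupport (HasCompactSupport.of_compactSpace _)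
  have hub : a * ∫ z : (GaugeConfig 3 L (Matrix.specialUnitaryGroup (Fin 2) ℂ)) × (GaugeConfig 3 L (Matrix.specialUnitaryGroup (Fin 2) ℂ)), torusRiemannDistSq (fundamentalLatticeRep 2) z.1 z.2 ∂(q : Measure _) ∈
      upperBounds (Literature.MeasureTheory.OptimalTransport.dualValues (κ t ∘ₘ ν) (κ t ∘ₘ ν') c) := by
    rintro r ⟨φ, ψ, hφψ, rfl⟩
    exact wilson_W2_pairs_of_coupling L β' hβ κ hreal ht φ.continuous ψ.continuous (fun u v => hφψ u v) ν ν' q.2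
  have hcost : ∫ z, c z ∂π ≤ a * ∫ z : (GaugeConfig 3 L (Matrix.specialUnitaryGroup (Fin 2) ℂ)) × (GaugeConfig 3 L (Matrix.specialUnitaryGroup (Fin 2) ℂ)), torusRiemannDistSq (fundamentalLatticeRep 2) z.1 z.2 ∂(q : Measure _) := hlub.2 hub
  rw [← ofReal_integral_eq_lintegral_ofReal hρq (ae_of_all _ fun z => hnn z.1 z.2), ← ENNReal.ofReal_mul ha0.le]
  exact ENNReal.ofReal_le_ofReal hcost

/-! ## §3. Convergence to the Wilson–Gibbs law in `W₂` -/

/-- ★★★ **`W₂` convergence to equilibrium from every initial law**: `W₂²(νP_t, μ_(β')) ≤ e^(−2(1−12|β'|)t)·W₂²(ν, μ_(β'))` for `t > 0` (the Wilson–Gibbs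
law `μ_(β')` is invariant under every realising kernel, `wilson_invariant_of_fact`). [cite: ShenZhuZhu2022, Theorem 4.2 (4.5)] -/
theorem wilson_szzWasserstein_W2_convergence_of_initialLaw (L : ℕ) [NeZero L]
    (ν : Measure (GaugeConfig 3 L (Matrix.specialUnitaryGroup (Fin 2) ℂ))) [IsProbabilityMeasure ν] (β' : ℝ) (hβ : |β'| < 1 / 12)
    (κ : ℝ≥0 → Kernel (GaugeConfig 3 L (Matrix.specialUnitaryGroup (Fin 2) ℂ))
      (GaugeConfig 3 L (Matrix.specialUnitaryGroup (Fin 2) ℂ))) [∀ t, IsMarkovKernel (κ t)]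
    (hreal : ∀ (t : ℝ≥0) (x : GaugeConfig 3 L (Matrix.specialUnitaryGroup (Fin 2) ℂ))
        (Ω : Type) [MeasurableSpace Ω] (P : Measure Ω) [IsProbabilityMeasure P]
        (W : ℝ≥0 → Ω → (Edge 3 L × NoiseIdx 2 → ℝ)) (hW : IsFlatBrownian W P)
        (U : ℝ≥0 → Ω → GaugeConfig 3 L (Matrix.specialUnitaryGroup (Fin 2) ℂ)),
        (∀ ω, U 0 ω = x) →
        (latticeLangevinDynamics (fundamentalLatticeRep 2) β').IsSolution (fundamentalRep (Fin 2))
          hW.natFiltration P W U →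
        κ t x = P.map (U t))
    {t : ℝ≥0} (ht : 0 < (t : ℝ)) :
    szzWassersteinSq (torusRiemannDistSq (fundamentalLatticeRep 2)) (κ t ∘ₘ ν) (wilsonMeasure (d := 3) (L := L) (fundamentalRep (Fin 2)) β') ≤
      ENNReal.ofReal (Real.exp (-(2 * (1 - 12 * |β'|) * (t : ℝ)))) *
        szzWassersteinSq (torusRiemannDistSq (fundamentalLatticeRep 2)) ν (wilsonMeasure (d := 3) (L := L) (fundamentalRep (Fin 2)) β') := by
  haveI : IsProbabilityMeasure (wilsonMeasure (d := 3) (L := L) (fundamentalRep (Fin 2)) β') :=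
    isProbabilityMeasure_wilsonMeasure (d := 3) (L := L) (fundamentalRep (Fin 2)) (continuous_fundamentalRep (Fin 2)) β'
  have hinv : (wilsonMeasure (d := 3) (L := L) (fundamentalRep (Fin 2)) β').bind (κ t) = (wilsonMeasure (d := 3) (L := L) (fundamentalRep (Fin 2)) β') :=
    (wilson_invariant_of_fact L β' (wilsonMeasureLangevinInvariant_su2 L β') κ hreal t).def
  have h := wilson_szzWasserstein_W2_contraction_of_initialLaws L ν (wilsonMeasure (d := 3) (L := L) (fundamentalRep (Fin 2)) β') β' hβ κ hreal ht
  rw [hinv] at h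
  exact h

/-- ★★ **`W₂²(δ_Q, μ) ≤ ∫ρ_L(Q,·)² dμ`**: the product coupling `δ_Q ⊗ μ`. [folklore] -/
theorem szzWasserstein_W2_dirac_le (Q : GaugeConfig 3 L (Matrix.specialUnitaryGroup (Fin 2) ℂ)) (μ : Measure (GaugeConfig 3 L (Matrix.specialUnitaryGroup (Fin 2) ℂ))) [IsProbabilityMeasure μ] :
    szzWassersteinSq (torusRiemannDistSq (fundamentalLatticeRep 2)) (Measure.dirac Q) μ ≤
      ENNReal.ofReal (∫ Q', torusRiemannDistSq (fundamentalLatticeRep 2) Q Q' ∂μ) := by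
  haveI := secondCountableTopology_su2
  haveI := borelSpace_config L
  have hc := Literature.Geometry.Riemannian.isCoupling_prod (Measure.dirac Q) μ
  have hnn : ∀ Q' : GaugeConfig 3 L (Matrix.specialUnitaryGroup (Fin 2) ℂ), 0 ≤ torusRiemannDistSq (fundamentalLatticeRep 2) Q Q' := fun Q' => by
    unfold torusRiemannDistSq; exact Finset.sum_nonneg fun _ _ => sq_nonneg _
  have hρc : Continuous fun Q' : GaugeConfig 3 L (Matrix.specialUnitaryGroup (Fin 2) ℂ) => torusRiemannDistSq (fundamentalLatticeRep 2) Q Q' :=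
    continuous_torusRiemannDistSq_two_right Q
  have hρi : Integrable (fun Q' : GaugeConfig 3 L (Matrix.specialUnitaryGroup (Fin 2) ℂ) => torusRiemannDistSq (fundamentalLatticeRep 2) Q Q') μ :=
    hρc.integrable_of_hasCompactSupport (HasCompactSupport.of_compactSpace _)
  calc szzWassersteinSq (torusRiemannDistSq (fundamentalLatticeRep 2)) (Measure.dirac Q) μ
      ≤ ∫⁻ z, ENNReal.ofReal (torusRiemannDistSq (fundamentalLatticeRep 2) z.1 z.2) ∂((Measure.dirac Q).prod μ) := szzWassersteinSq_le _ hc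
    _ ≤ ∫⁻ Q', ENNReal.ofReal (torusRiemannDistSq (fundamentalLatticeRep 2) Q Q') ∂μ := by
        rw [Measure.dirac_prod]
        exact lintegral_map_le _ _
    _ = ENNReal.ofReal (∫ Q', torusRiemannDistSq (fundamentalLatticeRep 2) Q Q' ∂μ) :=
        (ofReal_integral_eq_lintegral_ofReal hρi (ae_of_all _ hnn)).symm

/-- ★★★ **`W₂` geometric ergodicity from a cold start**: `W₂²(κ_t(Q,·), μ_(β')) ≤ ofReal(e^(−2(1−12|β'|)t)·∫ρ_L(Q,·)² dμ_(β'))` for every deterministic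
start `Q`, every `L`, `|β'| < 1/12`, `t > 0`. [cite: ShenZhuZhu2022, Theorem 4.2 (4.5)] -/
theorem wilson_szzWasserstein_W2_convergence_dirac (L : ℕ) [NeZero L] (Q : GaugeConfig 3 L (Matrix.specialUnitaryGroup (Fin 2) ℂ)) (β' : ℝ) (hβ : |β'| < 1 / 12)
    (κ : ℝ≥0 → Kernel (GaugeConfig 3 L (Matrix.specialUnitaryGroup (Fin 2) ℂ))
      (GaugeConfig 3 L (Matrix.specialUnitaryGroup (Fin 2) ℂ))) [∀ t, IsMarkovKernel (κ t)]
    (hreal : ∀ (t : ℝ≥0) (x : GaugeConfig 3 L (Matrix.specialUnitaryGroup (Fin 2) ℂ))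
        (Ω : Type) [MeasurableSpace Ω] (P : Measure Ω) [IsProbabilityMeasure P]
        (W : ℝ≥0 → Ω → (Edge 3 L × NoiseIdx 2 → ℝ)) (hW : IsFlatBrownian W P)
        (U : ℝ≥0 → Ω → GaugeConfig 3 L (Matrix.specialUnitaryGroup (Fin 2) ℂ)),
        (∀ ω, U 0 ω = x) →
        (latticeLangevinDynamics (fundamentalLatticeRep 2) β').IsSolution (fundamentalRep (Fin 2))
          hW.natFiltration P W U →
        κ t x = P.map (U t))
    {t : ℝ≥0} (ht : 0 < (t : ℝ)) :
    szzWassersteinSq (torusRiemannDistSq (fundamentalLatticeRep 2)) (κ t Q) (wilsonMeasure (d := 3) (L := L) (fundamentalRep (Fin 2)) β') ≤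
      ENNReal.ofReal (Real.exp (-(2 * (1 - 12 * |β'|) * (t : ℝ))) *
        ∫ Q', torusRiemannDistSq (fundamentalLatticeRep 2) Q Q' ∂(wilsonMeasure (d := 3) (L := L) (fundamentalRep (Fin 2)) β')) := by
  haveI : IsProbabilityMeasure (wilsonMeasure (d := 3) (L := L) (fundamentalRep (Fin 2)) β') :=
    isProbabilityMeasure_wilsonMeasure (d := 3) (L := L) (fundamentalRep (Fin 2)) (continuous_fundamentalRep (Fin 2)) β'
  have hbind : κ t ∘ₘ Measure.dirac Q = κ t Q := by
    rw [Measure.dirac_bind (κ t).measurable]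
  have h := wilson_szzWasserstein_W2_convergence_of_initialLaw L (Measure.dirac Q) β' hβ κ hreal ht
  rw [hbind] at h
  rw [ENNReal.ofReal_mul (Real.exp_pos _).le]
  exact h.trans (mul_le_mul' le_rfl (szzWasserstein_W2_dirac_le Q (wilsonMeasure (d := 3) (L := L) (fundamentalRep (Fin 2)) β')))

/-- ★★★ **`W₂` geometric ergodicity from a cold start, diameter form**: `W₂²(κ_t(Q,·), μ_(β')) ≤ ofReal(e^(−2(1−12|β'|)t)·2π²·#E)` (`ρ_L² ≤ 2π²·#E`).
[cite: ShenZhuZhu2022, Theorem 4.2 (4.5)] -/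
theorem wilson_szzWasserstein_W2_convergence_dirac_diam (L : ℕ) [NeZero L] (Q : GaugeConfig 3 L (Matrix.specialUnitaryGroup (Fin 2) ℂ)) (β' : ℝ) (hβ : |β'| < 1 / 12)
    (κ : ℝ≥0 → Kernel (GaugeConfig 3 L (Matrix.specialUnitaryGroup (Fin 2) ℂ))
      (GaugeConfig 3 L (Matrix.specialUnitaryGroup (Fin 2) ℂ))) [∀ t, IsMarkovKernel (κ t)]
    (hreal : ∀ (t : ℝ≥0) (x : GaugeConfig 3 L (Matrix.specialUnitaryGroup (Fin 2) ℂ))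
        (Ω : Type) [MeasurableSpace Ω] (P : Measure Ω) [IsProbabilityMeasure P]
        (W : ℝ≥0 → Ω → (Edge 3 L × NoiseIdx 2 → ℝ)) (hW : IsFlatBrownian W P)
        (U : ℝ≥0 → Ω → GaugeConfig 3 L (Matrix.specialUnitaryGroup (Fin 2) ℂ)),
        (∀ ω, U 0 ω = x) →
        (latticeLangevinDynamics (fundamentalLatticeRep 2) β').IsSolution (fundamentalRep (Fin 2))
          hW.natFiltration P W U →
        κ t x = P.map (U t))
    {t : ℝ≥0} (ht : 0 < (t : ℝ)) :
    szzWassersteinSq (torusRiemannDistSq (fundamentalLatticeRep 2)) (κ t Q) (wilsonMeasure (d := 3) (L := L) (fundamentalRep (Fin 2)) β') ≤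
      ENNReal.ofReal (Real.exp (-(2 * (1 - 12 * |β'|) * (t : ℝ))) * (2 * Real.pi ^ 2 * Fintype.card (Edge 3 L))) := by
  haveI : IsProbabilityMeasure (wilsonMeasure (d := 3) (L := L) (fundamentalRep (Fin 2)) β') :=
    isProbabilityMeasure_wilsonMeasure (d := 3) (L := L) (fundamentalRep (Fin 2)) (continuous_fundamentalRep (Fin 2)) β'
  haveI := borelSpace_config L
  refine (wilson_szzWasserstein_W2_convergence_dirac L Q β' hβ κ hreal ht).trans (ENNReal.ofReal_le_ofReal ?_)
  refine mul_le_mul_of_nonneg_left ?_ (Real.exp_pos _).le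
  have hρc : Continuous fun Q' : GaugeConfig 3 L (Matrix.specialUnitaryGroup (Fin 2) ℂ) => torusRiemannDistSq (fundamentalLatticeRep 2) Q Q' :=
    continuous_torusRiemannDistSq_two_right Q
  have hρi : Integrable (fun Q' : GaugeConfig 3 L (Matrix.specialUnitaryGroup (Fin 2) ℂ) => torusRiemannDistSq (fundamentalLatticeRep 2) Q Q') (wilsonMeasure (d := 3) (L := L) (fundamentalRep (Fin 2)) β') :=
    hρc.integrable_of_hasCompactSupport (HasCompactSupport.of_compactSpace _)
  calc ∫ Q', torusRiemannDistSq (fundamentalLatticeRep 2) Q Q' ∂(wilsonMeasure (d := 3) (L := L) (fundamentalRep (Fin 2)) β')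
      ≤ ∫ _Q', 2 * Real.pi ^ 2 * Fintype.card (Edge 3 L) ∂(wilsonMeasure (d := 3) (L := L) (fundamentalRep (Fin 2)) β') :=
        integral_mono hρi (integrable_const _) fun Q' => torusRiemannDistSq_two_le_card Q Q'
    _ = 2 * Real.pi ^ 2 * Fintype.card (Edge 3 L) := by rw [integral_const, probReal_univ, one_smul]

end Summit.QuantumFields.YangMills.Theorems.ColdStartUniversality

end
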